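import Summits.AtomisticToContinuum.HydrodynamicLimit.Theorems.AntiMazurCoboundariesCellForecastPressureDecayKinematicAssemblyNoCollision
import Literature.Analysis.FluidPDE.HardSphereBilliard
import HarnessLib

/-!
# S2d · kinematic assembly, pieces 2 & 6: fresh collisions, no recollision, isolated pairs of the slab
# (registered sub-goal `stub_kinematicAssembly_isolatedPair` of stub `stub_kinematicAssembly`, crux line
# `enskog-compensator-martingale`, crux `CellForecastPressureDecay`, stmt-AtomisticToContinuum-13915)

Deterministic two-body kinematics INSIDE a hard-sphere trajectory of `ℝᵈ`: the spheres whose collision cluster in the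
slab `[0, Δ]` has at most two elements contribute to `KinematicRates σ` (stub S2d) exactly the static pair functional
of `stub_kinematicAssembly_mainTerm`.
* `fresh_collision` — spheres `i ≠ j` in contact at `t`, neither having collided on `(a, t)`, flew freely (piece 1):
  the impact vector `n = q + (t − a) u` (`q = xᵢ(a) − xⱼ(a)`, `u = vᵢ(a) − vⱼ(a)`) has `‖n‖ = ε`, `⟪n, u⟫ < 0`, and the
  time-`t` velocities are `reflectVel n (vᵢ(a), vⱼ(a))`; `mem_cylinder_of_fresh_collision` — `q = ε ω − (t − a) u`,
  `⟪ω, u⟫ < 0`: `q` lies in Boltzmann's collision cylinder.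
* `not_mem_contactSet_after` — **no recollision**: after the jump the pair is outgoing, so while neither sphere meets a
  third one the free relative motion separates it (`‖n + τ u'‖² = ε² + 2τ⟪n, u'⟫ + τ²‖u'‖² > ε²`).
* `isolated_pair`, `stub_kinematicAssembly_isolatedPair` (registered, whole-cell flow, window `(0, Δ]`) — if every
  collision of `i` is with `j` and conversely, then either neither collides (velocities unchanged, `q ∉ Cyl`) or there
  is exactly one, fresh, collision (`q = σ ω − t u ∈ Cyl`, time-`Δ` velocities `reflectVel (σ ω) (vᵢ, vⱼ)`).

References: Gallagher–Saint-Raymond–Texier 2013, §4.1 (Def. 4.1.2); Cercignani–Illner–Pulvirenti 1994, §2.2, §4.2.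
-/

noncomputable section

open MeasureTheory ProbabilityTheory Set Filter Topology
open scoped ENNReal BigOperators InnerProductSpace
open Literature.Analysis.FluidPDE Literature.MathematicalPhysics.KineticTheory

namespace Summit.AtomisticToContinuum.HydrodynamicLimit.Theorems.EnskogCompensator

/-! ## Trajectory level, Euclidean geometry of any dimension -/

section Trajectory

variable {d : Type*} [Fintype d] {N : ℕ} {ε : ℝ} {γ : ℝ → Config N d (EuclideanSpace ℝ d)}

omit [Fintype d] in
/-- Relative position after a common free flight: `(x + s v) − (y + s w) = (x − y) + s (v − w)`. [folklore] -/
theorem sub_add_smul_sub (x y v w : EuclideanSpace ℝ d) (s : ℝ) :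
    (x + s • v) - (y + s • w) = (x - y) + s • (v - w) := by
  rw [smul_sub]; abel

/-- **A fresh pair collides by the two-body kinematics.** On a hard-sphere trajectory in `ℝᵈ`, if the
spheres `i ≠ j` are in contact at time `t > a` and neither took part in a collision at the times of
`(a, t)`, then with `q = xᵢ(a) − xⱼ(a)`, `u = vᵢ(a) − vⱼ(a)` and the impact vector `n = q + (t − a) u`:
`‖n‖ = ε`, `⟪n, u⟫ < 0`, and the states at time `t` are the freely flown positions with the elastically
reflected velocities `reflectVel n (vᵢ(a), vⱼ(a))`. [cite: GST2013, §4.1 Def. 4.1.2] -/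
theorem fresh_collision (h : IsHardSphereTrajectory (Euclidean.geometry d) ε N γ) {a t : ℝ} (hat : a < t)
    {i j : Fin N} (hij : i ≠ j) (hc : γ t ∈ contactSet (Euclidean.geometry d) N ε i j)
    (hi : ∀ s ∈ Ioo a t, ¬ Participates (Euclidean.geometry d) ε (γ s) i)
    (hj : ∀ s ∈ Ioo a t, ¬ Participates (Euclidean.geometry d) ε (γ s) j) :
    ‖((γ a i).1 - (γ a j).1) + (t - a) • ((γ a i).2 - (γ a j).2)‖ = ε ∧
    ⟪((γ a i).1 - (γ a j).1) + (t - a) • ((γ a i).2 - (γ a j).2), (γ a i).2 - (γ a j).2⟫_ℝ < 0 ∧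
    γ t i = ((γ a i).1 + (t - a) • (γ a i).2,
      (reflectVel (((γ a i).1 - (γ a j).1) + (t - a) • ((γ a i).2 - (γ a j).2))
        ((γ a i).2, (γ a j).2)).1) ∧
    γ t j = ((γ a j).1 + (t - a) • (γ a j).2,
      (reflectVel (((γ a i).1 - (γ a j).1) + (t - a) • ((γ a i).2 - (γ a j).2))
        ((γ a i).2, (γ a j).2)).2) := by
  set G := Euclidean.geometry d with hG
  have hGc : ∀ x, Continuous (G.translate x) := fun x =>
    (continuous_const.add continuous_id : Continuous fun v : EuclideanSpace ℝ d => x + v)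
  -- a point `y ∈ (a, t)` with `(y, t)` collision-free
  obtain ⟨s₀, hs₀t, hfree⟩ := h.exists_Ioo_left_free t
  set y : ℝ := max ((a + t) / 2) ((s₀ + t) / 2) with hy
  have hyt : y < t := max_lt (by linarith) (by linarith)
  have hay : a < y := lt_of_lt_of_le (by linarith) (le_max_left _ _)
  have hsy : s₀ < y := lt_of_lt_of_le (by linarith) (le_max_right _ _)
  have hfree' : ∀ s ∈ Ioo y t, s ∉ collisionTimes G ε γ := fun s hs => hfree s ⟨hsy.trans hs.1, hs.2⟩
  -- both spheres fly freely on `[a, y]`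
  have hiy : γ y i = (G.translate (γ a i).1 ((y - a) • (γ a i).2), (γ a i).2) :=
    apply_eq_freeFlight_of_forall_not_participates h hGc hay.le fun s hs => hi s ⟨hs.1, hs.2.trans_lt hyt⟩
  have hjy : γ y j = (G.translate (γ a j).1 ((y - a) • (γ a j).2), (γ a j).2) :=
    apply_eq_freeFlight_of_forall_not_participates h hGc hay.le fun s hs => hj s ⟨hs.1, hs.2.trans_lt hyt⟩
  -- the left limit at `t` is the free flight from `γ y`
  set zl : Config N d (EuclideanSpace ℝ d) := freeFlight G (t - y) (γ y) with hzl
  have hlim : Tendsto γ (𝓝[<] t) (𝓝 zl) := h.tendsto_nhdsLT hGc hyt hfree'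
  have hzli : zl i = ((γ a i).1 + (t - a) • (γ a i).2, (γ a i).2) := by
    simp only [hzl, freeFlight_apply, hiy, Euclidean.geometry_translate, hG]
    refine Prod.ext ?_ rfl
    simp only [add_assoc, ← add_smul]
    congr 2
    ring
  have hzlj : zl j = ((γ a j).1 + (t - a) • (γ a j).2, (γ a j).2) := by
    simp only [hzl, freeFlight_apply, hjy, Euclidean.geometry_translate, hG]
    refine Prod.ext ?_ rfl
    simp only [add_assoc, ← add_smul]
    congr 2
    ring
  -- the binary clause at `t`
  obtain ⟨-, zl', hzl', hin, heq⟩ := h.binary t i j hij hc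
  have hzz : zl' = zl := tendsto_nhds_unique hzl' hlim
  subst hzz
  have hsep : G.sepVec (zl i).1 (zl j).1 = ((γ a i).1 - (γ a j).1) + (t - a) • ((γ a i).2 - (γ a j).2) := by
    rw [hzli, hzlj, hG, Euclidean.geometry_sepVec, sub_add_smul_sub]
  have hvel : ((zl i).2, (zl j).2) = ((γ a i).2, (γ a j).2) := by rw [hzli, hzlj]
  refine ⟨?_, ?_, ?_, ?_⟩
  · -- contact: positions at `t` are those of the left limit
    have h1 := (mem_contactSet.1 hc).2
    rw [heq, collidePair_apply_fst, collidePair_apply_fst, hsep] at h1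
    exact h1
  · -- incoming left limit
    have h2 : ⟪G.sepVec (zl i).1 (zl j).1, (zl i).2 - (zl j).2⟫_ℝ < 0 := hin
    rw [hsep, hzli, hzlj] at h2
    exact h2
  · rw [heq, collidePair_apply_left hij, hsep, hvel, hzli]
  · rw [heq, collidePair_apply_right, hsep, hvel, hzlj]

/-- **The fresh pair lies in the collision cylinder**: under the hypotheses of `fresh_collision`,
`q = ε ω − (t − a) u` for a unit vector `ω` with `⟪ω, u⟫ < 0` (the incoming impact direction), so that
`‖q‖ ≤ ε + (t − a) ‖u‖`. [cite: CIP1994, §2.2] -/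
theorem mem_cylinder_of_fresh_collision (h : IsHardSphereTrajectory (Euclidean.geometry d) ε N γ)
    {a t : ℝ} (hat : a < t) {i j : Fin N} (hij : i ≠ j)
    (hc : γ t ∈ contactSet (Euclidean.geometry d) N ε i j)
    (hi : ∀ s ∈ Ioo a t, ¬ Participates (Euclidean.geometry d) ε (γ s) i)
    (hj : ∀ s ∈ Ioo a t, ¬ Participates (Euclidean.geometry d) ε (γ s) j) :
    (∃ ω : Metric.sphere (0 : EuclideanSpace ℝ d) 1, ⟪(ω : EuclideanSpace ℝ d), (γ a i).2 - (γ a j).2⟫_ℝ < 0 ∧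
      (γ a i).1 - (γ a j).1 = ε • (ω : EuclideanSpace ℝ d) - (t - a) • ((γ a i).2 - (γ a j).2)) ∧
    ‖(γ a i).1 - (γ a j).1‖ ≤ ε + (t - a) * ‖(γ a i).2 - (γ a j).2‖ := by
  obtain ⟨hnorm, hin, -, -⟩ := fresh_collision h hat hij hc hi hj
  set q := (γ a i).1 - (γ a j).1 with hq
  set u := (γ a i).2 - (γ a j).2 with hu
  set nv := q + (t - a) • u with hnv
  have hn0 : nv ≠ 0 := by
    rintro h0
    rw [h0, inner_zero_left] at hin
    exact lt_irrefl _ hin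
  have hε : 0 < ε := hnorm ▸ norm_pos_iff.2 hn0
  have hback : q = nv - (t - a) • u := by rw [hnv, add_sub_cancel_right]
  refine ⟨⟨unitDir nv hn0, ?_, ?_⟩, ?_⟩
  · change ⟪‖nv‖⁻¹ • nv, u⟫_ℝ < 0
    rw [real_inner_smul_left, hnorm]
    exact mul_neg_of_pos_of_neg (inv_pos.2 hε) hin
  · change q = ε • (‖nv‖⁻¹ • nv) - (t - a) • u
    rw [smul_smul, hnorm, mul_inv_cancel₀ hε.ne', one_smul]
    exact hback
  · calc ‖q‖ = ‖nv - (t - a) • u‖ := by rw [hback]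
      _ ≤ ‖nv‖ + ‖(t - a) • u‖ := norm_sub_le _ _
      _ = ε + (t - a) * ‖u‖ := by rw [hnorm, norm_smul, Real.norm_of_nonneg (by linarith)]

/-! ## No recollision: after its collision a freely flying pair separates -/

/-- Contact is symmetric in `ℝᵈ`. [folklore] -/
theorem mem_contactSet_comm {z : Config N d (EuclideanSpace ℝ d)} {i j : Fin N} :
    z ∈ contactSet (Euclidean.geometry d) N ε i j ↔ z ∈ contactSet (Euclidean.geometry d) N ε j i := by
  simp only [mem_contactSet, Euclidean.geometry_sepVec, norm_sub_rev]

/-- If `i` collides with `k` then `(i, k)` is a contact pair (Euclidean geometry). [folklore] -/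
theorem mem_contactSet_of_collide {z : Config N d (EuclideanSpace ℝ d)} {i k : Fin N}
    (h : Collide (Euclidean.geometry d) ε z i k) : z ∈ contactSet (Euclidean.geometry d) N ε i k := by
  rcases h with h | h
  · exact (mem_contactPairs.1 h).2
  · exact mem_contactSet_comm.1 (mem_contactPairs.1 h).2

/-- Positions of a sphere that does not participate on `(a, b)` are the freely flown ones up to and including
time `b` (positions are continuous). [folklore] -/
theorem fst_eq_of_forall_not_participates_Ioo (h : IsHardSphereTrajectory (Euclidean.geometry d) ε N γ)
    {a b : ℝ} (hab : a < b) {i : Fin N}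
    (hi : ∀ s ∈ Ioo a b, ¬ Participates (Euclidean.geometry d) ε (γ s) i) :
    (γ b i).1 = (γ a i).1 + (b - a) • (γ a i).2 := by
  have hGc : ∀ x, Continuous ((Euclidean.geometry d).translate x) := fun x =>
    (continuous_const.add continuous_id : Continuous fun v : EuclideanSpace ℝ d => x + v)
  have h1 : Tendsto (fun s => (γ s i).1) (𝓝[<] b) (𝓝 (γ b i).1) := ((h.pos_continuous i).tendsto b).mono_left nhdsWithin_le_nhds
  have h2 : Tendsto (fun s => (γ s i).1) (𝓝[<] b) (𝓝 ((γ a i).1 + (b - a) • (γ a i).2)) := by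
    have hc : Continuous fun s : ℝ => (γ a i).1 + (s - a) • (γ a i).2 := by fun_prop
    refine ((hc.tendsto b).mono_left nhdsWithin_le_nhds).congr' ?_
    filter_upwards [Ioo_mem_nhdsLT hab] with s hs
    rw [apply_eq_freeFlight_of_forall_not_participates h hGc hs.1.le (fun τ hτ => hi τ ⟨hτ.1, hτ.2.trans_lt hs.2⟩)]
    rfl
  exact tendsto_nhds_unique h1 h2

/-- **No recollision.** If the spheres `i ≠ j` are in contact at time `t` and on `(t, t')` every collision
of `i` and every collision of `j` is a collision of the pair `{i, j}`, then the pair is NOT in contact at any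
time of `(t, t']`: after the elastic jump the pair is outgoing and the free relative motion separates it
(`‖q + τ u'‖² = σ² + 2τ⟪q, u'⟫ + τ²‖u'‖² > σ²`). In particular neither sphere participates on `(t, t')`.
[cite: CIP1994, §4.2] -/
theorem not_mem_contactSet_after (h : IsHardSphereTrajectory (Euclidean.geometry d) ε N γ) {t t' : ℝ}
    {i j : Fin N} (hij : i ≠ j) (hc : γ t ∈ contactSet (Euclidean.geometry d) N ε i j)
    (hi : ∀ s ∈ Ioo t t', ∀ k, Collide (Euclidean.geometry d) ε (γ s) i k → k = j)
    (hj : ∀ s ∈ Ioo t t', ∀ k, Collide (Euclidean.geometry d) ε (γ s) j k → k = i) :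
    ∀ s ∈ Ioc t t', γ s ∉ contactSet (Euclidean.geometry d) N ε i j := by
  set G := Euclidean.geometry d with hG
  -- the pair is outgoing right after the jump
  have hout : 0 < ⟪(γ t i).1 - (γ t j).1, (γ t i).2 - (γ t j).2⟫_ℝ := by
    obtain ⟨-, zl, -, hin, heq⟩ := h.binary t i j hij hc
    have hout' : IsOutgoing G (γ t) i j := heq ▸ (isOutgoing_collidePair_iff hij zl).2 hin
    exact hout'
  have hnorm : ‖(γ t i).1 - (γ t j).1‖ = ε := (mem_contactSet.1 hc).2
  -- suppose a contact of the pair in `(t, t']`; take the first participation of `i` after `t`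
  intro s hs hcs
  have hpart_s : Participates G ε (γ s) i := ⟨j, Or.inl (mem_contactPairs.2 ⟨hij, hcs⟩)⟩
  have hne : (collisionTimesOf G ε γ i ∩ Ioi t).Nonempty := ⟨s, hpart_s, hs.1⟩
  have hleast := h.isLeast_nthCollisionTimeOf_zero hne
  set s₁ := nthCollisionTimeOf G ε γ t i 0 with hs₁
  have hs₁t : t < s₁ := hleast.1.2
  have hs₁s : s₁ ≤ s := hleast.2 ⟨hpart_s, hs.1⟩
  have hs₁t' : s₁ ≤ t' := hs₁s.trans hs.2
  have hpart₁ : Participates G ε (γ s₁) i := hleast.1.1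
  -- no participation of `i`, hence of `j`, on `(t, s₁)`
  have hfree_i : ∀ τ ∈ Ioo t s₁, ¬ Participates G ε (γ τ) i := fun τ hτ hp =>
    (not_lt.2 (hleast.2 ⟨hp, hτ.1⟩)) hτ.2
  have hfree_j : ∀ τ ∈ Ioo t s₁, ¬ Participates G ε (γ τ) j := by
    rintro τ hτ ⟨k, hk⟩
    have hk' := hj τ ⟨hτ.1, hτ.2.trans_le hs₁t'⟩ k hk
    subst hk'
    exact hfree_i τ hτ ⟨j, hk.symm⟩
  -- positions at `s₁` are the freely flown ones, so the pair is strictly separated there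
  have hxi := fst_eq_of_forall_not_participates_Ioo h hs₁t hfree_i
  have hxj := fst_eq_of_forall_not_participates_Ioo h hs₁t hfree_j
  have hsep : ε < ‖(γ s₁ i).1 - (γ s₁ j).1‖ := by
    rw [hxi, hxj, sub_add_smul_sub]
    have hε : 0 ≤ ε := hnorm ▸ norm_nonneg _
    have hsq : ε ^ 2 < ‖((γ t i).1 - (γ t j).1) + (s₁ - t) • ((γ t i).2 - (γ t j).2)‖ ^ 2 := by
      rw [norm_add_sq_real, hnorm, inner_smul_right, norm_smul]
      have h1 : 0 < (s₁ - t) * ⟪(γ t i).1 - (γ t j).1, (γ t i).2 - (γ t j).2⟫_ℝ := mul_pos (by linarith) hout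
      nlinarith [sq_nonneg (‖s₁ - t‖ * ‖(γ t i).2 - (γ t j).2‖)]
    exact lt_of_pow_lt_pow_left₀ 2 (norm_nonneg _) hsq
  -- but `i` participates at `s₁`, necessarily with `j`: contradiction
  have hcontact : γ s₁ ∈ contactSet G N ε i j := by
    rcases hs₁t'.eq_or_lt with h₁ | h₁
    · -- `s₁ = t'`: then `s = t'` and the assumed contact is at `s₁`
      have : s = s₁ := le_antisymm (h₁ ▸ hs.2) hs₁s
      rw [← this]; exact hcs
    · obtain ⟨k, hk⟩ := hpart₁
      have := hi s₁ ⟨hs₁t, h₁⟩ k hk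
      subst this
      exact mem_contactSet_of_collide hk
  have := (mem_contactSet.1 hcontact).2
  rw [hG, Euclidean.geometry_sepVec] at this
  exact (ne_of_gt hsep) this

/-- Under the hypotheses of `not_mem_contactSet_after`, neither sphere participates in any collision on
`(t, t')`. [cite: CIP1994, §4.2] -/
theorem not_participates_after (h : IsHardSphereTrajectory (Euclidean.geometry d) ε N γ) {t t' : ℝ}
    {i j : Fin N} (hij : i ≠ j) (hc : γ t ∈ contactSet (Euclidean.geometry d) N ε i j)
    (hi : ∀ s ∈ Ioo t t', ∀ k, Collide (Euclidean.geometry d) ε (γ s) i k → k = j)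
    (hj : ∀ s ∈ Ioo t t', ∀ k, Collide (Euclidean.geometry d) ε (γ s) j k → k = i) :
    ∀ s ∈ Ioo t t', ¬ Participates (Euclidean.geometry d) ε (γ s) i ∧
      ¬ Participates (Euclidean.geometry d) ε (γ s) j := by
  intro s hs
  have hno := not_mem_contactSet_after h hij hc hi hj s ⟨hs.1, hs.2.le⟩
  constructor
  · rintro ⟨k, hk⟩
    have := hi s hs k hk; subst this
    exact hno (mem_contactSet_of_collide hk)
  · rintro ⟨k, hk⟩
    have := hj s hs k hk; subst this
    exact hno (mem_contactSet_comm.1 (mem_contactSet_of_collide hk))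

/-- **An isolated pair collides at most once, by the two-body kinematics.** On a hard-sphere trajectory in `ℝᵈ`,
suppose that on `(a, b]` every collision of `i` is with `j` and every collision of `j` is with `i` (`i ≠ j`,
`a < b`). Then EITHER neither sphere participates in any collision on `(a, b]` — so both fly freely, and the
relative position does not lie in the collision cylinder of the window — OR there is exactly one collision, a
fresh one at a time `t ∈ (a, b]` (`fresh_collision`), after which both fly freely up to `b` with the reflected
velocities. [cite: CIP1994, §4.2] -/
theorem isolated_pair (h : IsHardSphereTrajectory (Euclidean.geometry d) ε N γ) {a b : ℝ} (hab : a < b)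
    {i j : Fin N} (hij : i ≠ j)
    (hi : ∀ s ∈ Ioc a b, ∀ k, Collide (Euclidean.geometry d) ε (γ s) i k → k = j)
    (hj : ∀ s ∈ Ioc a b, ∀ k, Collide (Euclidean.geometry d) ε (γ s) j k → k = i) :
    ((∀ s ∈ Ioc a b, ¬ Participates (Euclidean.geometry d) ε (γ s) i ∧
        ¬ Participates (Euclidean.geometry d) ε (γ s) j) ∧
      ∀ t ∈ Ioc a b, ‖((γ a i).1 - (γ a j).1) + (t - a) • ((γ a i).2 - (γ a j).2)‖ ≠ ε) ∨
    ∃ t ∈ Ioc a b, γ t ∈ contactSet (Euclidean.geometry d) N ε i j ∧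
      (∀ s ∈ Ioo a t, ¬ Participates (Euclidean.geometry d) ε (γ s) i ∧
        ¬ Participates (Euclidean.geometry d) ε (γ s) j) ∧
      γ b i = ((γ t i).1 + (b - t) • (γ t i).2, (γ t i).2) ∧
      γ b j = ((γ t j).1 + (b - t) • (γ t j).2, (γ t j).2) := by
  set G := Euclidean.geometry d with hG
  have hGc : ∀ x, Continuous (G.translate x) := fun x =>
    (continuous_const.add continuous_id : Continuous fun v : EuclideanSpace ℝ d => x + v)
  -- `j` participates only when `i` does
  have hji : ∀ s ∈ Ioc a b, Participates G ε (γ s) j → Participates G ε (γ s) i := by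
    rintro s hs ⟨k, hk⟩
    have := hj s hs k hk; subst this
    exact ⟨j, hk.symm⟩
  by_cases hne : (collisionTimesOf G ε γ i ∩ Ioc a b).Nonempty
  · right
    obtain ⟨s₀, hs₀p, hs₀⟩ := hne
    have hne' : (collisionTimesOf G ε γ i ∩ Ioi a).Nonempty := ⟨s₀, hs₀p, hs₀.1⟩
    have hleast := h.isLeast_nthCollisionTimeOf_zero hne'
    set t := nthCollisionTimeOf G ε γ a i 0 with ht
    have hat : a < t := hleast.1.2
    have htb : t ≤ b := (hleast.2 ⟨hs₀p, hs₀.1⟩).trans hs₀.2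
    have hpart : Participates G ε (γ t) i := hleast.1.1
    have hfree_i : ∀ τ ∈ Ioo a t, ¬ Participates G ε (γ τ) i := fun τ hτ hp =>
      (not_lt.2 (hleast.2 ⟨hp, hτ.1⟩)) hτ.2
    have hfree_j : ∀ τ ∈ Ioo a t, ¬ Participates G ε (γ τ) j := fun τ hτ hp =>
      hfree_i τ hτ (hji τ ⟨hτ.1, hτ.2.le.trans htb⟩ hp)
    have hc : γ t ∈ contactSet G N ε i j := by
      obtain ⟨k, hk⟩ := hpart
      have := hi t ⟨hat, htb⟩ k hk; subst this
      exact mem_contactSet_of_collide hk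
    rcases htb.eq_or_lt with rfl | htb'
    · exact ⟨t, ⟨hat, le_rfl⟩, hc, fun s hs => ⟨hfree_i s hs, hfree_j s hs⟩, by simp, by simp⟩
    have hi' : ∀ s ∈ Ioo t b, ∀ k, Collide G ε (γ s) i k → k = j := fun s hs => hi s ⟨hat.trans hs.1, hs.2.le⟩
    have hj' : ∀ s ∈ Ioo t b, ∀ k, Collide G ε (γ s) j k → k = i := fun s hs => hj s ⟨hat.trans hs.1, hs.2.le⟩
    have hnp := not_participates_after h hij hc hi' hj'
    -- no participation on `(t, b]`: at `b` itself a participation would be a contact of the pair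
    have hno := not_mem_contactSet_after h hij hc hi' hj'
    have hnpi : ∀ s ∈ Ioc t b, ¬ Participates G ε (γ s) i := by
      intro s hs
      rcases hs.2.eq_or_lt with rfl | hsb
      · rintro ⟨k, hk⟩
        have := hi s ⟨hat.trans hs.1, hs.2⟩ k hk
        subst this
        exact hno s ⟨hs.1, le_rfl⟩ (mem_contactSet_of_collide hk)
      · exact (hnp s ⟨hs.1, hsb⟩).1
    have hnpj : ∀ s ∈ Ioc t b, ¬ Participates G ε (γ s) j := by
      intro s hs
      rcases hs.2.eq_or_lt with rfl | hsb
      · rintro ⟨k, hk⟩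
        have := hj s ⟨hat.trans hs.1, hs.2⟩ k hk
        subst this
        exact hno s ⟨hs.1, le_rfl⟩ (mem_contactSet_comm.1 (mem_contactSet_of_collide hk))
      · exact (hnp s ⟨hs.1, hsb⟩).2
    exact ⟨t, ⟨hat, htb⟩, hc, fun s hs => ⟨hfree_i s hs, hfree_j s hs⟩,
      apply_eq_freeFlight_of_forall_not_participates h hGc htb'.le hnpi,
      apply_eq_freeFlight_of_forall_not_participates h hGc htb'.le hnpj⟩
  · left
    have hnpi : ∀ s ∈ Ioc a b, ¬ Participates G ε (γ s) i := fun s hs hp => hne ⟨s, hp, hs⟩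
    have hnpj : ∀ s ∈ Ioc a b, ¬ Participates G ε (γ s) j := fun s hs hp => hnpi s hs (hji s hs hp)
    refine ⟨fun s hs => ⟨hnpi s hs, hnpj s hs⟩, fun t ht hnorm => ?_⟩
    -- both fly freely up to `t`: a contact at `t` would be a participation of `i`
    have hxi := apply_eq_freeFlight_of_forall_not_participates h hGc ht.1.le
      (fun s hs => hnpi s ⟨hs.1, hs.2.trans ht.2⟩)
    have hxj := apply_eq_freeFlight_of_forall_not_participates h hGc ht.1.le
      (fun s hs => hnpj s ⟨hs.1, hs.2.trans ht.2⟩)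
    have hct : γ t ∈ contactSet G N ε i j := by
      refine mem_contactSet.2 ⟨h.mem t, ?_⟩
      rw [hxi, hxj, hG, Euclidean.geometry_sepVec]
      change ‖((γ a i).1 + (t - a) • (γ a i).2) - ((γ a j).1 + (t - a) • (γ a j).2)‖ = ε
      rw [sub_add_smul_sub]
      exact hnorm
    exact hnpi t ht ⟨j, Or.inl (mem_contactPairs.2 ⟨hij, hct⟩)⟩

end Trajectory

/-! ## The registered sub-goal: isolated pairs of the whole-cell flow -/

/-- **Registered sub-goal `stub_kinematicAssembly_isolatedPair`** (piece of stub `stub_kinematicAssembly`, S2d, of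
the line `enskog-compensator-martingale`): **an isolated pair of the slab contributes exactly the static pair
functional.** Along the whole-cell flow of a good datum `z`, if on `(0, Δ]` every collision of `i` is with `j` and
every collision of `j` is with `i` (`i ≠ j`: the pair is a cluster of the slab), then with `q = xᵢ − xⱼ`,
`u = vᵢ − vⱼ`: EITHER both velocities are unchanged at time `Δ` and `q` is NOT in the collision cylinder
`{σ ω − t u : ⟪ω, u⟫ < 0, t ∈ (0, Δ]}`, OR `q = σ ω − t u` lies in it and the time-`Δ` velocities are the
two-body reflected ones `reflectVel (σ ω) (vᵢ, vⱼ)` — so that in both cases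
`w(vᵢ(Δ)) + w(vⱼ(Δ)) − w(vᵢ) − w(vⱼ) = φ(q)` for the pair functional of `stub_kinematicAssembly_mainTerm`
(no recollision after an elastic collision; fresh-pair kinematics). [cite: CIP1994, §4.2] -/
theorem stub_kinematicAssembly_isolatedPair : ∀ (σ : ℝ) (n : ℕ) (Ψ : Flows σ) (z : Cell n), z ∈ (Ψ n).good → 0 < σ →
    ∀ (i j : Fin n) (Δ : ℝ), i ≠ j → 0 < Δ →
      (∀ s ∈ Set.Ioc 0 Δ, ∀ k, Collide (Euclidean.geometry (Fin 3)) σ ((Ψ n).flow s z) i k → k = j) →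
      (∀ s ∈ Set.Ioc 0 Δ, ∀ k, Collide (Euclidean.geometry (Fin 3)) σ ((Ψ n).flow s z) j k → k = i) →
        (((Ψ n).flow Δ z i).2 = (z i).2 ∧ ((Ψ n).flow Δ z j).2 = (z j).2 ∧
          ¬ ∃ (ω : Metric.sphere (0 : V3) 1) (t : ℝ), t ∈ Set.Ioc 0 Δ ∧ inner ℝ (ω : V3) ((z i).2 - (z j).2) < 0 ∧
            (z i).1 - (z j).1 = σ • (ω : V3) - t • ((z i).2 - (z j).2)) ∨
        (∃ (ω : Metric.sphere (0 : V3) 1) (t : ℝ), t ∈ Set.Ioc 0 Δ ∧ inner ℝ (ω : V3) ((z i).2 - (z j).2) < 0 ∧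
          (z i).1 - (z j).1 = σ • (ω : V3) - t • ((z i).2 - (z j).2) ∧
          ((Ψ n).flow Δ z i).2 = (reflectVel (σ • (ω : V3)) ((z i).2, (z j).2)).1 ∧
          ((Ψ n).flow Δ z j).2 = (reflectVel (σ • (ω : V3)) ((z i).2, (z j).2)).2) := by
  intro σ n Ψ z hz hσ i j Δ hij hΔ hi hj
  have htraj := (Ψ n).isTrajectory z hz
  have h0 : (Ψ n).flow 0 z = z := (Ψ n).flow_zero z hz
  have hGc : ∀ x, Continuous ((Euclidean.geometry (Fin 3)).translate x) := fun x =>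
    (continuous_const.add continuous_id : Continuous fun v : V3 => x + v)
  rcases isolated_pair htraj hΔ hij hi hj with ⟨hnp, hnohit⟩ | ⟨t, ht, hc, hfresh, hbi, hbj⟩
  · left
    have hvi := apply_eq_freeFlight_of_forall_not_participates htraj hGc hΔ.le (fun s hs => (hnp s hs).1)
    have hvj := apply_eq_freeFlight_of_forall_not_participates htraj hGc hΔ.le (fun s hs => (hnp s hs).2)
    rw [h0] at hvi hvj hnohit
    refine ⟨by rw [hvi], by rw [hvj], ?_⟩
    rintro ⟨ω, t, ht, -, hq⟩
    have hω : ‖(ω : V3)‖ = 1 := by simp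
    refine hnohit t ht ?_
    rw [sub_zero, hq, sub_add_cancel, norm_smul, hω, mul_one, Real.norm_of_nonneg hσ.le]
  · right
    have hfc := fresh_collision htraj ht.1 hij hc (fun s hs => (hfresh s hs).1) (fun s hs => (hfresh s hs).2)
    have hcyl := (mem_cylinder_of_fresh_collision htraj ht.1 hij hc (fun s hs => (hfresh s hs).1)
      (fun s hs => (hfresh s hs).2)).1
    rw [h0] at hfc hcyl
    simp only [sub_zero] at hfc hcyl
    obtain ⟨-, -, hti, htj⟩ := hfc
    obtain ⟨ω, hωu, hq⟩ := hcyl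
    have hn : ((z i).1 - (z j).1) + t • ((z i).2 - (z j).2) = σ • (ω : V3) := by rw [hq, sub_add_cancel]
    rw [hn] at hti htj
    refine ⟨ω, t, ht, hωu, hq, ?_, ?_⟩
    · rw [hbi]
      change ((Ψ n).flow t z i).2 = _
      rw [hti]
    · rw [hbj]
      change ((Ψ n).flow t z j).2 = _
      rw [htj]

end Summit.AtomisticToContinuum.HydrodynamicLimit.Theorems.EnskogCompensator
end
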